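import Mathlib.RingTheory.Unramified.Field
import Mathlib.RingTheory.Kaehler.Basic
import Mathlib.FieldTheory.SeparablyGenerated
import Mathlib.RingTheory.AlgebraicIndependent.TranscendenceBasis
import Mathlib.FieldTheory.PrimitiveElement
import Mathlib.FieldTheory.IsAlgClosed.AlgebraicClosure
import Literature.AlgebraicGeometry.Resolution.GenericForms

/-!
# `WeightedInvariant.WeightedThesis`, line `datum-glued-split`, stub 5 (hypersurface models), III:
# differentials of separably generated extensions and the two generic field conditions

Third of four files for `stub_hypersurfaceModel` (crux `WeightedThesis`,
stmt-ResolutionOfSingularities-0569); pure field theory, all PROVED: `Ω[K⁄k]` is spanned by the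
differentials of `S` when `K/k(S)` is separable (`span_D_eq_top_of_isSeparable`, so
`dim Ω[K⁄k] ≤ #S`); conversely if `dS` spans `Ω[K⁄k]` (`K/k` essentially of finite type) then
`K/k(S)` is finite separable (`isSeparable_of_span_D_eq_top`, Mathlib
`Algebra.FormallyUnramified.iff_isSeparable`) and `trdeg ≤ dim Ω[K⁄k]`; missing a subspace under a
`k`-linear map of parameters and being a primitive element are GENERIC conditions
(`isGeneric_not_mem`, `isGeneric_primitive`, `isGeneric_D_not_mem_span`,
`isGeneric_adjoin_simple_eq_top`; `IsGeneric` of `Literature/…/GenericForms`).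
[Hartshorne II Thm. 8.6A; Matsumura, Commutative Ring Theory, §26; folklore]
-/

noncomputable section

set_option linter.dupNamespace false -- mandated namespace of this single-conjunct summit

open scoped TensorProduct

namespace Summit.ResolutionOfSingularities.ResolutionOfSingularities.Theorems.WeightedThesis.HypersurfaceModel

namespace FieldCore

variable {k K : Type*} [Field k] [Field K] [Algebra k K]

/-- The elements of `K` whose differential lies in a given `K`-subspace `W ⊆ Ω[K⁄k]` form a
subfield containing `k`. [folklore] -/
theorem D_mem_of_mem_closure (W : Submodule K (Ω[K⁄k])) {S : Set K}
    (hS : ∀ s ∈ S, KaehlerDifferential.D k K s ∈ W) {x : K}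
    (hx : x ∈ Subfield.closure (Set.range (algebraMap k K) ∪ S)) :
    KaehlerDifferential.D k K x ∈ W := by
  induction hx using Subfield.closure_induction with
  | mem y hy =>
    rcases hy with ⟨c, rfl⟩ | hy
    · rw [Derivation.map_algebraMap]; exact W.zero_mem
    · exact hS y hy
  | one => rw [Derivation.map_one_eq_zero]; exact W.zero_mem
  | add y z _ _ hy hz => rw [map_add]; exact W.add_mem hy hz
  | neg y _ hy => rw [map_neg]; exact W.neg_mem hy
  | inv y _ hy => rw [Derivation.leibniz_inv]; exact W.smul_mem _ hy
  | mul y z _ _ hy hz => rw [Derivation.leibniz]; exact W.add_mem (W.smul_mem _ hz) (W.smul_mem _ hy)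

/-- The differential of an element of `k(S)` lies in the span of the differentials of `S`.
[folklore] -/
theorem D_mem_span_of_mem_adjoin {S : Set K} {x : K} (hx : x ∈ IntermediateField.adjoin k S) :
    KaehlerDifferential.D k K x ∈ Submodule.span K (KaehlerDifferential.D k K '' S) := by
  refine D_mem_of_mem_closure _ (fun s hs => Submodule.subset_span (Set.mem_image_of_mem _ hs)) ?_
  rwa [← IntermediateField.adjoin_toSubfield]

/-- **`Ω[K⁄k]` is spanned by the differentials of `S` as soon as `K / k(S)` is separable
(algebraic)**: `Ω[K ⁄ k(S)] = 0`, so `K ⊗ Ω[k(S)⁄k] → Ω[K⁄k]` is onto, and the differentials of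
the elements of `k(S)` lie in the span of those of `S`. [folklore] -/
theorem span_D_eq_top_of_isSeparable (S : Set K)
    [Algebra.IsSeparable (IntermediateField.adjoin k S) K] :
    Submodule.span K (KaehlerDifferential.D k K '' S) = ⊤ := by
  set E := IntermediateField.adjoin k S with hE
  haveI : Algebra.FormallyUnramified E K := Algebra.FormallyUnramified.of_isSeparable E K
  set W : Submodule K (Ω[K⁄k]) := Submodule.span K (KaehlerDifferential.D k K '' S) with hW
  -- the image of `Ω[E⁄k]` lies in `W`
  have hmap : ∀ η : Ω[E⁄k], KaehlerDifferential.map k k E K η ∈ W := by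
    intro η
    have hη : η ∈ Submodule.span E (Set.range (KaehlerDifferential.D k E)) := by
      rw [KaehlerDifferential.span_range_derivation]; trivial
    induction hη using Submodule.span_induction with
    | mem ω hω =>
      obtain ⟨e, rfl⟩ := hω
      rw [KaehlerDifferential.map_D]
      exact D_mem_span_of_mem_adjoin e.2
    | zero => rw [map_zero]; exact W.zero_mem
    | add ω ω' _ _ h h' => rw [map_add]; exact W.add_mem h h'
    | smul e ω _ h =>
      rw [map_smul]
      exact W.smul_of_tower_mem e h
  -- `K ⊗ Ω[E⁄k] → Ω[K⁄k]` is onto since `Ω[K⁄E] = 0`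
  have hrange : LinearMap.range (KaehlerDifferential.mapBaseChange k E K) = ⊤ := by
    rw [KaehlerDifferential.range_mapBaseChange, eq_top_iff]
    exact fun x _ => Subsingleton.elim _ _
  rw [eq_top_iff, ← hrange]
  rintro _ ⟨t, rfl⟩
  induction t using TensorProduct.induction_on with
  | zero => rw [map_zero]; exact W.zero_mem
  | tmul a η => rw [KaehlerDifferential.mapBaseChange_tmul]; exact W.smul_mem a (hmap η)
  | add t t' h h' => rw [map_add]; exact W.add_mem h h'

/-- Consequently `dim_K Ω[K⁄k] ≤ #S` for a finite such `S` (and `Ω[K⁄k]` is finite-dimensional).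
[folklore] -/
theorem finrank_le_of_isSeparable (S : Finset K)
    [Algebra.IsSeparable (IntermediateField.adjoin k (S : Set K)) K] :
    Module.Finite K (Ω[K⁄k]) ∧ Module.finrank K (Ω[K⁄k]) ≤ S.card := by
  have h := span_D_eq_top_of_isSeparable (k := k) (S : Set K)
  classical
  rw [← Finset.coe_image] at h
  constructor
  · exact ⟨h ▸ Submodule.fg_span (Finset.finite_toSet _)⟩
  · rw [← finrank_top, ← h]
    exact (finrank_span_finset_le_card _).trans Finset.card_image_le

/-- **If the differentials of `S` span `Ω[K⁄k]` then `K / k(S)` is finite separable** (for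
`K / k` essentially of finite type): `Ω[K ⁄ k(S)]`, a quotient of `Ω[K⁄k]` killing the `ds`,
`s ∈ S`, vanishes, so `K / k(S)` is formally unramified, hence finite separable
(Mathlib `Algebra.FormallyUnramified.isSeparable`, `finite_of_free`). [folklore] -/
theorem isSeparable_of_span_D_eq_top [Algebra.EssFiniteType k K] (S : Set K)
    (hS : Submodule.span K (KaehlerDifferential.D k K '' S) = ⊤) :
    Algebra.IsSeparable (IntermediateField.adjoin k S) K ∧
      Module.Finite (IntermediateField.adjoin k S) K := by
  set E := IntermediateField.adjoin k S with hE
  have hzero : KaehlerDifferential.map k E K K = 0 := by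
    rw [← LinearMap.ker_eq_top, eq_top_iff, ← hS, Submodule.span_le]
    rintro _ ⟨s, hs, rfl⟩
    rw [SetLike.mem_coe, LinearMap.mem_ker, KaehlerDifferential.map_D]
    exact Derivation.map_algebraMap (KaehlerDifferential.D E K)
      (⟨s, IntermediateField.subset_adjoin k S hs⟩ : E)
  have hsub : Subsingleton (Ω[K⁄E]) := by
    refine ⟨fun a b => ?_⟩
    obtain ⟨a, rfl⟩ := KaehlerDifferential.map_surjective k E K a
    obtain ⟨b, rfl⟩ := KaehlerDifferential.map_surjective k E K b
    rw [hzero]; rfl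
  haveI : Algebra.FormallyUnramified E K := ⟨hsub⟩
  haveI : Algebra.EssFiniteType E K := Algebra.EssFiniteType.of_comp k E K
  haveI := Algebra.FormallyUnramified.finite_of_free (R := E) (S := K)
  exact ⟨Algebra.FormallyUnramified.isSeparable E K, inferInstance⟩

/-- Hence `trdeg_k K ≤ #S` if the differentials of the finite set `S` span `Ω[K⁄k]`.
[folklore] -/
theorem trdeg_le_of_span_D_eq_top [Algebra.EssFiniteType k K] (S : Finset K)
    (hS : Submodule.span K (KaehlerDifferential.D k K '' (S : Set K)) = ⊤) :
    Algebra.trdeg k K ≤ S.card := by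
  obtain ⟨hsep, -⟩ := isSeparable_of_span_D_eq_top (k := k) (S : Set K) hS
  haveI : Algebra.IsAlgebraic (Algebra.adjoin k (S : Set K)) K :=
    IntermediateField.isAlgebraic_adjoin_iff_top.mp (Algebra.IsSeparable.isAlgebraic _ _)
  have h := Algebra.IsAlgebraic.trdeg_le_cardinalMk k (S : Set K) (A := K)
  simpa using h

/-- **`trdeg_k K ≤ dim_K Ω[K⁄k]`** for `K / k` essentially of finite type with `Ω[K⁄k]`
finite-dimensional: a basis of `Ω[K⁄k]` may be extracted from the spanning set `dK`, and
`K` is algebraic over the subfield generated by the corresponding elements. [folklore] -/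
theorem trdeg_le_finrank [Algebra.EssFiniteType k K] [Module.Finite K (Ω[K⁄k])] :
    Algebra.trdeg k K ≤ Module.finrank K (Ω[K⁄k]) := by
  classical
  obtain ⟨κ, a, ha, hspan, hli⟩ := exists_linearIndependent' K (KaehlerDifferential.D k K : K → Ω[K⁄k])
  rw [KaehlerDifferential.span_range_derivation] at hspan
  haveI : Finite κ := hli.finite
  letI : Fintype κ := Fintype.ofFinite κ
  let T : Finset K := Finset.univ.image a
  have hT : KaehlerDifferential.D k K '' (T : Set K) = Set.range (KaehlerDifferential.D k K ∘ a) := by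
    rw [Finset.coe_image, Finset.coe_univ, Set.image_univ, Set.range_comp]
  have hTspan : Submodule.span K (KaehlerDifferential.D k K '' (T : Set K)) = ⊤ := by rw [hT, hspan]
  refine (trdeg_le_of_span_D_eq_top (k := k) T hTspan).trans ?_
  have hcard : T.card = Fintype.card κ := Finset.card_image_of_injective _ ha
  have hfr : Module.finrank K (Ω[K⁄k]) = Fintype.card κ := by
    rw [← finrank_top, ← hspan, finrank_span_eq_card hli]
  rw [hcard, hfr]

/-! ## Generic conditions: missing a subspace; primitive elements -/

open Literature.AlgebraicGeometry.Resolution in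
/-- **Missing a proper subspace is a generic condition.** For a `k`-linear map `L` on the
parameter space `τ → k` and a subspace `W` not containing its image, `L c ∉ W` holds off the
zeros of a non-zero LINEAR polynomial: a functional vanishing on `L⁻¹ W` but not identically.
[folklore] -/
theorem isGeneric_not_mem {τ : Type*} [Fintype τ] [DecidableEq τ] {M : Type*} [AddCommGroup M]
    [Module k M] (L : (τ → k) →ₗ[k] M) (W : Submodule k M) {c₀ : τ → k} (h₀ : L c₀ ∉ W) :
    IsGeneric fun c : τ → k => L c ∉ W := by
  have hB : c₀ ∉ W.comap L := h₀
  obtain ⟨φ, hφ, hle⟩ := Submodule.exists_le_ker_of_notMem hB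
  let Φ : MvPolynomial τ k :=
    ∑ t, MvPolynomial.C (φ fun j => if t = j then 1 else 0) * MvPolynomial.X t
  have heval : ∀ c : τ → k, MvPolynomial.eval c Φ = φ c := fun c => by
    rw [LinearMap.pi_apply_eq_sum_univ φ c]
    simp only [Φ, map_sum, map_mul, MvPolynomial.eval_C, MvPolynomial.eval_X, smul_eq_mul]
    exact Finset.sum_congr rfl fun t _ => mul_comm _ _
  refine ⟨Φ, fun hΦ => hφ ?_, fun c hc hcW => ?_⟩
  · rw [← heval, hΦ, map_zero]
  · rw [heval] at hc
    exact hc (LinearMap.mem_ker.mp (hle hcW))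

open Literature.AlgebraicGeometry.Resolution in
/-- **Being a primitive element is a generic condition.** Let `E ⊆ F'` be a finite separable
extension of fields containing `k`, and `L : (τ → k) → F'` a `k`-linear map whose image
generates `F'` over `E`. Then `E⟮L c⟯ = F'` for `c` off the zeros of a non-zero polynomial:
`L c` is primitive iff the finitely many `E`-embeddings of `F'` into an algebraic closure take
distinct values at it, and for each pair of distinct embeddings this is the non-vanishing of a
non-zero `k`-linear map (`isGeneric_not_mem`). [folklore] -/
theorem isGeneric_primitive {τ : Type*} [Fintype τ] [DecidableEq τ] {E F' : Type*} [Field E]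
    [Field F'] [Algebra E F'] [FiniteDimensional E F'] [Algebra.IsSeparable E F']
    [Algebra k F'] [Algebra k E] [IsScalarTower k E F']
    (L : (τ → k) →ₗ[k] F') (hL : IntermediateField.adjoin E (Set.range L) = ⊤) :
    IsGeneric fun c : τ → k => IntermediateField.adjoin E {L c} = ⊤ := by
  classical
  let A := AlgebraicClosure F'
  have hA : ∀ x : F', ((minpoly E x).map (algebraMap E A)).Splits := fun x =>
    IsAlgClosed.splits _
  -- for a pair of distinct embeddings, `ψ (L c) ≠ ψ' (L c)` generically
  have hpair : ∀ ψ ψ' : F' →ₐ[E] A, ψ ≠ ψ' → IsGeneric fun c : τ → k => ψ (L c) ≠ ψ' (L c) := by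
    intro ψ ψ' hne
    -- some `L c₀` separates `ψ` and `ψ'`
    have hex : ∃ c₀, ψ (L c₀) ≠ ψ' (L c₀) := by
      by_contra hall
      push Not at hall
      apply hne
      have hfix : ∀ x ∈ IntermediateField.adjoin E (Set.range L), ψ x = ψ' x := by
        intro x hx
        induction hx using IntermediateField.adjoin_induction with
        | mem x hx => obtain ⟨c, rfl⟩ := hx; exact hall c
        | algebraMap x => rw [AlgHom.commutes, AlgHom.commutes]
        | add x y _ _ hx hy => rw [map_add, map_add, hx, hy]
        | inv x _ hx => rw [map_inv₀, map_inv₀, hx]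
        | mul x y _ _ hx hy => rw [map_mul, map_mul, hx, hy]
      exact AlgHom.ext fun x => hfix x (hL ▸ IntermediateField.mem_top)
    obtain ⟨c₀, hc₀⟩ := hex
    let L' : (τ → k) →ₗ[k] A :=
      (ψ.toLinearMap.restrictScalars k).comp L - (ψ'.toLinearMap.restrictScalars k).comp L
    have hL' : ∀ c, L' c = ψ (L c) - ψ' (L c) := fun c => rfl
    have h₀ : L' c₀ ∉ (⊥ : Submodule k A) := by
      rw [Submodule.mem_bot, hL', sub_eq_zero]; exact hc₀
    refine (isGeneric_not_mem L' ⊥ h₀).mono fun c hc => ?_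
    rw [Submodule.mem_bot, hL', sub_eq_zero] at hc
    exact hc
  -- all pairs at once
  have hall : IsGeneric fun c : τ → k => ∀ p : (F' →ₐ[E] A) × (F' →ₐ[E] A),
      p.1 ≠ p.2 → p.1 (L c) ≠ p.2 (L c) := by
    refine IsGeneric.forall_fintype fun p => ?_
    by_cases hp : p.1 = p.2
    · exact IsGeneric.of_forall fun c h => (h hp).elim
    · exact (hpair p.1 p.2 hp).mono fun c h _ => h
  refine hall.mono fun c hc => ?_
  rw [Field.primitive_element_iff_algHom_eq_of_eval' E A hA (L c)]
  intro ψ ψ' h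
  by_contra hne
  exact hc (ψ, ψ') hne h

end FieldCore

/-! ## The two generic field conditions of the sequential choice -/

namespace FieldCore

open Literature.AlgebraicGeometry.Resolution

variable {k K : Type*} [Field k] [Field K] [Algebra k K] {τ : Type*} [Fintype τ] [DecidableEq τ]

/-- If `k(S) = K` then the differentials of `S` span `Ω[K⁄k]`. [folklore] -/
theorem span_D_image_eq_top_of_adjoin_eq_top {S : Set K} (hS : IntermediateField.adjoin k S = ⊤) :
    Submodule.span K (KaehlerDifferential.D k K '' S) = ⊤ := by
  rw [eq_top_iff, ← KaehlerDifferential.span_range_derivation, Submodule.span_le]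
  rintro _ ⟨x, rfl⟩
  exact D_mem_span_of_mem_adjoin (hS ▸ IntermediateField.mem_top)

/-- **Generic differential independence.** For a `k`-linear `V : (τ → k) → K` and `f₀ ∈ K` with
`k(V c / f₀ : c) = K`, and fewer than `dim_K Ω[K⁄k]` vectors `w_i`, the condition
`d(V c / f₀) ∉ span_K (d w_i)` is generic in `c`. [folklore] -/
theorem isGeneric_D_not_mem_span [Module.Finite K (Ω[K⁄k])] (V : (τ → k) →ₗ[k] K) (f₀ : K)
    (hV : IntermediateField.adjoin k (Set.range fun c => V c / f₀) = ⊤) {m : ℕ} (w : Fin m → K)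
    (hm : m < Module.finrank K (Ω[K⁄k])) :
    IsGeneric fun c : τ → k => KaehlerDifferential.D k K (V c / f₀) ∉
      Submodule.span K (Set.range fun i => KaehlerDifferential.D k K (w i)) := by
  set W := Submodule.span K (Set.range fun i => KaehlerDifferential.D k K (w i)) with hW
  -- the `k`-linear map `c ↦ d(V c / f₀)`
  let L : (τ → k) →ₗ[k] Ω[K⁄k] := (KaehlerDifferential.D k K).toLinearMap.comp (f₀⁻¹ • V)
  have hL : ∀ c, L c = KaehlerDifferential.D k K (V c / f₀) := fun c => by
    simp [L, div_eq_inv_mul]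
  -- `W ≠ Ω`, and the `d(V c / f₀)` span `Ω`, so one of them misses `W`
  have hWtop : W ≠ ⊤ := by
    intro h
    have h1 : Module.finrank K W ≤ m := by
      rw [hW]
      exact (finrank_range_le_card _).trans (Fintype.card_fin m).le
    rw [h, finrank_top] at h1
    omega
  have hex : ∃ c₀, KaehlerDifferential.D k K (V c₀ / f₀) ∉ W := by
    by_contra hall
    push Not at hall
    apply hWtop
    rw [eq_top_iff, ← span_D_image_eq_top_of_adjoin_eq_top hV, Submodule.span_le]
    rintro _ ⟨_, ⟨c, rfl⟩, rfl⟩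
    exact hall c
  obtain ⟨c₀, hc₀⟩ := hex
  have h₀ : L c₀ ∉ W.restrictScalars k := by rw [Submodule.restrictScalars_mem, hL]; exact hc₀
  refine (isGeneric_not_mem L (W.restrictScalars k) h₀).mono fun c hc => ?_
  rwa [Submodule.restrictScalars_mem, hL] at hc

/-- **Generic primitivity of the last ratio.** For `V`, `f₀` as above with `K / k` essentially of
finite type and `w₁, …, w_d` with INDEPENDENT differentials, `d = dim_K Ω[K⁄k]` (so that
`K / k(w)` is finite separable, `isSeparable_of_span_D_eq_top`), the condition
`k(w)⟮V c / f₀⟯ = K` is generic in `c` (`isGeneric_primitive`). [folklore] -/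
theorem isGeneric_adjoin_simple_eq_top [Algebra.EssFiniteType k K] [Module.Finite K (Ω[K⁄k])]
    (V : (τ → k) →ₗ[k] K) (f₀ : K)
    (hV : IntermediateField.adjoin k (Set.range fun c => V c / f₀) = ⊤) {d : ℕ} (w : Fin d → K)
    (hw : LinearIndependent K fun i => KaehlerDifferential.D k K (w i))
    (hd : Module.finrank K (Ω[K⁄k]) = d) :
    IsGeneric fun c : τ → k =>
      IntermediateField.adjoin (IntermediateField.adjoin k (Set.range w)) {V c / f₀} = ⊤ := by
  set K₀ := IntermediateField.adjoin k (Set.range w) with hK₀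
  have hspan : Submodule.span K (KaehlerDifferential.D k K '' Set.range w) = ⊤ := by
    rw [← Set.range_comp]
    exact hw.span_eq_top_of_card_eq_finrank' (by rw [hd, Fintype.card_fin])
  obtain ⟨hsep, hfin⟩ := isSeparable_of_span_D_eq_top (k := k) (Set.range w) hspan
  haveI := hsep
  haveI := hfin
  -- the generators over `k` generate over `K₀`
  let L : (τ → k) →ₗ[k] K := f₀⁻¹ • V
  have hLc : ∀ c, L c = V c / f₀ := fun c => by simp [L, div_eq_inv_mul]
  have hL : IntermediateField.adjoin K₀ (Set.range L) = ⊤ := by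
    have hr : Set.range L = Set.range fun c => V c / f₀ := by
      ext x; simp only [Set.mem_range, hLc]
    rw [eq_top_iff]
    intro x _
    have hx : x ∈ IntermediateField.adjoin k (Set.range fun c => V c / f₀) := hV ▸ IntermediateField.mem_top
    rw [← hr] at hx
    have hle : (IntermediateField.adjoin k (Set.range L) : Set K) ⊆
        IntermediateField.adjoin K₀ (Set.range L) := by
      rw [IntermediateField.adjoin_subset_adjoin_iff]
      constructor
      · rintro _ ⟨c, rfl⟩
        exact (IntermediateField.adjoin K₀ (Set.range L)).algebraMap_mem (algebraMap k K₀ c)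
      · exact IntermediateField.subset_adjoin _ _
    exact hle hx
  refine (isGeneric_primitive (k := k) L hL).mono fun c hc => ?_
  rwa [hLc] at hc

end FieldCore

/-- **Registered shape (universe `0`) of the generic primitive-ratio condition** (file III of
stub 5): for `K / k` essentially of finite type with `dim_K Ω[K⁄k] = d`, a `k`-linear
`V : (τ → k) → K` and `f₀` with `k(V c / f₀ : c) = K`, and `w : Fin d → K` with independent
differentials, `k(w)⟮V c / f₀⟯ = K` is generic in `c`. [folklore] -/
theorem stub_genericPrimitiveRatio : ∀ (k K : Type) [Field k] [Field K] [Algebra k K] [Algebra.EssFiniteType k K] [Module.Finite K (Ω[K⁄k])] (τ : Type) [Fintype τ] [DecidableEq τ] (V : (τ → k) →ₗ[k] K) (f₀ : K), IntermediateField.adjoin k (Set.range fun c => V c / f₀) = ⊤ → ∀ (d : ℕ) (w : Fin d → K), LinearIndependent K (fun i => KaehlerDifferential.D k K (w i)) → Module.finrank K (Ω[K⁄k]) = d → Literature.AlgebraicGeometry.Resolution.IsGeneric fun c : τ → k => IntermediateField.adjoin (IntermediateField.adjoin k (Set.range w)) {V c / f₀} = ⊤ :=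
  fun _ _ _ _ _ _ _ _ _ _ V f₀ hV _ w hw hd => FieldCore.isGeneric_adjoin_simple_eq_top V f₀ hV w hw hd

end Summit.ResolutionOfSingularities.ResolutionOfSingularities.Theorems.WeightedThesis.HypersurfaceModel

end
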